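import Summits.QuantumFields.YangMills.Theorems.BalabanUVNodesN12AtRecord13Prop1KnitThm1WindowLocalDatumScaleLettersDischargedAtLengthOfRegNameAndStepOfRecordTermPinnedAx
import Literature.MathematicalPhysics.QuantumFieldTheory.Balaban1983to89.Node00.Record13SepCoPHChi

/-!
# BalabanUVNodes ∕ N12 → K1ᴬ — THE N12 PIN OF RUNG 1ⱽᵂ (`NodesAtSomeRecord13PWSVW`, registered K1ᴬ skeleton v11 ∕ v11.1) AT THE BUNDLE OF RECORD: the glue between N12's
# window-local junction at the re-centred record (`…WindowLocal…TermPinnedAx`, this seat) and the rung's conjunct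
# `∃ λ, (∀ P, 1 ≤ P.K → λ.kSel P < P.K) ∧ ∀ P, λ.kSel P < P.K → (leavesP w P).smallCouplings → ((leavesP w P).rBasicStep ↔ B15Leaf (Node00.WOfRecord₁₃Ax F 2 θ.toStage13Params λ P))`

Cell `pub-ymgap` (HUMAN RULING D-0062), seat `pub-ymgap-dag-n12-d` g37 (R134 N12 [B15] s2 «knit at the record»); helper of K1ᴬ `stmt-QuantumFields-27239` (DECIDING,
`StabilityBRunRowsAtRecordR13SepCoPHVAx`), `--kind proof --supports … --as helper`, count-neutral; (4) of INTENT-1…4 (dag-lead g41 WORDS 645 (1) ∕ 647 (2), `K1AX-V11-LINE-TABLE.md` v1 row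
`stub_nodes13PWSVW`: «-b dag-n12-d g37 (N12 pin at the bundle of record)»; ✦ plan g100 OP5B (v11 54f620c18feea0f3) ∕ OP5B′ (v11.1 1c0150ff21ca0f8d = this seat's σ-row `WOfRecord₁₃ ↦ WOfRecord₁₃Ax`)).

WHAT IS HERE (theorems only; 0 `def`, 0 `instance`, 0 `sorry`; every proof `rfl` ∕ `Iff.rfl` ∕ a rewrite ∕ propositional logic — GLUE, no estimate):
* §0 THE LIVE RE-PIN IS IDEMPOTENT (`rfl` ×3: `liveRepin₁₃_liveRepin₁₃`, `liveRepin₁₃Chi_liveRepin₁₃Chi`, `liveRepin₁₃Ax_liveRepin₁₃Ax`) — so a rung-1 witness BUILT ON the live re-pin (the shape of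
  every NODE 00 `N24_…_pointed_liveRepin₁₃` world: `⟨⟨θ.liveRepin₁₃ F N, Zr⟩, Zh, Phih⟩`) reads N12's junction, which concludes at `Θ.liveRepin₁₃[Ax]`, AT ITSELF (`leafOnWindow_at_witness_of_eq`).
* §1 THE WINDOW GUARD OF RUNG 1ⱽᵂ IS N12's PER-RUN WINDOW ANTECEDENT (`Iff.rfl` behind one rewrite): for a world with `w.C = (Node00.datumOfRecord₁₃SepCoPHVAx F N θ h v).C` (`RecordSⱽ`'s clause)
  `(leavesP w P).smallCouplings ↔ Step.InInterval w.γ P.K (Node00.gOfRecord₁₃Ax F N θ.toStage13Params P)` (`Node00.flow_g_datumOfRecord₁₃SepCoPHVAx`); the same for `RecordS`'s clause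
  `w.C = (Node00.datumOfRecord₁₃SepCoPHAx F N θ h).C` (LINE 1).
* §2 THE STEP OF THE PIN: `λ.kSel P = P.K − 1` gives rung 1's first conjunct `∀ P, 1 ≤ P.K → λ.kSel P < P.K` (arithmetic).
* §3 THE CONJUNCT BY SHAPE (propositional logic over §1): from N12's leaf ON THE WINDOW RUNS at `θ.toStage13Params` — the conclusion shape of
  `…WindowLocal…TermPinnedAx.exists_constants_thresholds_radius_areg_pinLF_b15Leaf_WOfRecord₁₃_pinAllΛΩχZ_N0_liveRepin₁₃_windowLocalDatumScale_lettersDischargedAtLength_termPinned_ofRegNameGB_ofStepGB_ax`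
  after its `∃`s are opened, read at the witness by §0 — and the world's `rBasicStep` leaf (TRUE at an abstract-witness `W₀` world; the leaf itself at a W-pinned world,
  `Node00.upOfRecord₅C_pinW_rBasicStep_iff`), rung 1ⱽᵂ's N12 conjunct: `n12Pin_rung1VW_of_leafOnWindow` (abstract-`W₀` world) ∕ `n12Pin_rung1VW_of_rBasicStep_iff` (W-pinned world).
* §4 (v1.1, APPEND-ONLY) «AT THE RUNG's BOUND θ»: `ppSel_liveRepin₁₃Ax` (`rfl`), `liveRepin₁₃Chi_eq_self_of_ppSel` ∕ `liveRepin₁₃Ax_eq_self_of_ppSel` (structure η: a parameter whose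
  `p–p′` selector is the live one IS its own re-pin), `leafOnWindow_at_theta_of_ppSel_live` (N12's leaf at the rung's θ itself under that ONE row) — the live re-pin is about the SELECTOR
  field, not the centre; see §4's banner for why N12's road needs the live selector (`hmassSel` at any other selector asks positive mass of dead terms).
NOT HERE: the world, the other twelve nodes, the revision `v`, `RecordSⱽ` — the assembler's (-a dag-n24-c ∕ dag-n11-d ∕ dag-n13 ∕ dag-n06 lanes); N12's displayed rows — they stay displayed in the
junction (the (R) name, THE ONE-LENGTH STEP TOKEN (N07, no producer), `Adm`'s rows, NODE 00's `hres` ∕ live-mass, 12P's per-run rows, the β-sign box, (2.8a), the ℍ-leaves + (1.80), U4 rows).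

HONEST FRAMING.  Bookkeeping; nothing of Bałaban asserted; N12 NOT discharged; `stub_nodes13PWSVW` NOT closed (XL; thirteen nodes); K0ᴬ ∕ K1ᴬ ∕ K3ᴬ OPEN (K1ᴬ stubs 0∕6); counts
unmoved (discharged 8∕27 · K 1∕4); one finite 𝕋⁴ programme at fixed `ε = L^{-K}` — NOT continuum ∕ ℝ⁴ ∕ OS; NOT the Yang–Mills mass gap (Clay).
Sources (bookkeeping only): [Balaban1989LargeFieldI] (0.2)–(0.6) p.176 (the bundle the pin reads), (1.2) p.178 and [Balaban1987RG1] Thm 1 p.259 (the run's window `0 < g_k ≤ γ`), (0.17)–(0.20)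
pp.255–256 (the generated history), (2.9) p.266 with (2.3) p.265 (the re-centred cut-off); [Balaban1988Convergent] (3.22) p.269 (the live `p–p′` selector), (0.2) p.244 (the datum of record).
-/

noncomputable section

namespace Summit.QuantumFields.YangMills.BalabanUVNodes.N12PinAtRecordBundleForK1AxRung1VW

open Literature.MathematicalPhysics.QuantumFieldTheory.Balaban1983to89
open Literature.MathematicalPhysics.QuantumFieldTheory.Balaban1983to89.T4Continuum (T4Family)
open Literature.MathematicalPhysics.QuantumFieldTheory.Balaban1983to89.DagBinding
open Literature.MathematicalPhysics.QuantumFieldTheory.Balaban1983to89.Node00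

/-! ## §0  The live re-pin is idempotent (`rfl`): a witness built on the re-pin reads the junction at itself -/

section Idem

variable (F : T4Family) (N : ℕ) [NeZero N] (θ : Stage13Params F N) (χ : ChiSlot F N)

/-- The ₁₃ live re-pin is IDEMPOTENT (`rfl`: the live selector reads `ν`, `τ9`, `EOfRecord₁₃`, `wOfRecord₉` — all selector-blind). [cite: Balaban1988Convergent, (3.22) p.269; Balaban1989LargeFieldI, (0.3) p.176 (bookkeeping)] -/
theorem liveRepin₁₃_liveRepin₁₃ : (θ.liveRepin₁₃ F N).liveRepin₁₃ F N = θ.liveRepin₁₃ F N := rfl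

/-- The χ-generic ₁₃ live re-pin is IDEMPOTENT at a fixed slot `χ` (`rfl`). [cite: Balaban1988Convergent, (3.22) p.269; Balaban1987RG1, (2.9) p.266 (bookkeeping)] -/
theorem liveRepin₁₃Chi_liveRepin₁₃Chi : (θ.liveRepin₁₃Chi F N χ).liveRepin₁₃Chi F N χ = θ.liveRepin₁₃Chi F N χ := rfl

/-- The RE-CENTRED ₁₃ live re-pin is IDEMPOTENT (`rfl`: `chiβOfRecord₁₃Ax` reads `ν`, `ε₂₉` only — `Node00.Stage13Params.chiβOfRecord₁₃Ax_liveRepin₁₃Chi`).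
[cite: Balaban1988Convergent, (3.22) p.269; Balaban1987RG1, (2.9) p.266 with (2.3) p.265 (bookkeeping)] -/
theorem liveRepin₁₃Ax_liveRepin₁₃Ax : (θ.liveRepin₁₃Ax F N).liveRepin₁₃Ax F N = θ.liveRepin₁₃Ax F N := rfl

end Idem

/-! ## §1  Rung 1ⱽᵂ's window guard IS N12's per-run window antecedent -/

section Guard

variable {F : T4Family} {N : ℕ} [NeZero N]

/-- **THE WINDOW GUARD AT AN `RecordSⱽ` WORLD** (`w.C = (datumOfRecord₁₃SepCoPHVAx θ h v).C`): `(leavesP w P).smallCouplings` IS `Step.InInterval w.γ P.K (gOfRecord₁₃Ax θ P)` — the run's flow of the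
re-centred versioned datum is the re-centred history of record (`Node00.flow_g_datumOfRecord₁₃SepCoPHVAx`, `rfl`). [cite: Balaban1987RG1, Thm 1 p.259, (0.17)–(0.20) pp.255–256; Balaban1989LargeFieldI, (1.2) p.178 (bookkeeping)] -/
theorem smallCouplings_leavesP_iff_stepInInterval_gOfRecord₁₃Ax (θ : Stage13HParams F N) (h : θ.Provisos₁₃SepCoPHAx F N) (v : Revision₁₃Ax F N θ h) (w : WorldP)
    (hC : w.C = (datumOfRecord₁₃SepCoPHVAx F N θ h v).C) (P : B12.RunParams) :
    (leavesP w P).smallCouplings ↔ Step.InInterval w.γ P.K (gOfRecord₁₃Ax F N θ.toStage13Params P) := by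
  show (w.C P).flow.InInterval w.γ P.K ↔ _
  rw [hC]
  exact Iff.rfl

/-- The same at an `RecordS` world (LINE 1's clause `w.C = (datumOfRecord₁₃SepCoPHAx θ h).C`; the unversioned re-centred datum = the versioned one at `Revision₁₃Ax.refl`, `rfl`).
[cite: Balaban1987RG1, Thm 1 p.259, (0.17)–(0.20) pp.255–256 (bookkeeping)] -/
theorem smallCouplings_leavesP_iff_stepInInterval_gOfRecord₁₃Ax_of_recordS (θ : Stage13HParams F N) (h : θ.Provisos₁₃SepCoPHAx F N) (w : WorldP)
    (hC : w.C = (datumOfRecord₁₃SepCoPHAx F N θ h).C) (P : B12.RunParams) :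
    (leavesP w P).smallCouplings ↔ Step.InInterval w.γ P.K (gOfRecord₁₃Ax F N θ.toStage13Params P) :=
  smallCouplings_leavesP_iff_stepInInterval_gOfRecord₁₃Ax θ h (Revision₁₃Ax.refl F N θ h) w hC P

end Guard

/-! ## §2  The step of the pin: `λ.kSel P = P.K − 1` -/

section Step

variable {F : T4Family} {N : ℕ} [NeZero N]

/-- At `λ.kSel P := P.K − 1` the pin sits at a GENUINE step on every run with `1 ≤ P.K` (rung 1's first conjunct). [cite: Balaban1989LargeFieldI, (0.2) p.176 (bookkeeping: the basic step acts at a level below the torus)] -/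
theorem kSel_lt_of_kSel_eq_pred (lam : ResidW F N) (hk : ∀ P : B12.RunParams, lam.kSel P = P.K - 1) :
    ∀ P : B12.RunParams, 1 ≤ P.K → lam.kSel P < P.K := by
  intro P hP
  rw [hk P]
  omega

end Step

/-! ## §3  Rung 1ⱽᵂ's N12 conjunct BY SHAPE -/

section Conjunct

variable {F : T4Family}

/-- **READING THE JUNCTION AT THE WITNESS**: N12's window-local leaf at `Θ′` (e.g. `Θ′ := Θ.liveRepin₁₃Ax F 2`, the conclusion shape of
`…WindowLocal…TermPinnedAx.…_ofRegNameGB_ofStepGB_ax` once its `∃`s are opened) transports along `θ.toStage13Params = Θ′` (for a witness built ON the re-pin: §0) to the rung's parameter.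
[cite: Balaban1989LargeFieldI, (0.2)–(0.6) p.176, Prop. 1 p.194, (1.80) p.195, (1.89) p.198, (1.102) p.201 (the leaf; bookkeeping transport)] -/
theorem leafOnWindow_at_witness_of_eq (θ : Stage13HParams F 2) (Θ' : Stage13Params F 2) (hθ : θ.toStage13Params = Θ') (lam : ResidW F 2) (γ : ℝ)
    (hleaf : ∀ P : B12.RunParams, lam.kSel P < P.K → Step.InInterval γ P.K (gOfRecord₁₃Ax F 2 Θ' P) → B15Leaf (WOfRecord₁₃Ax F 2 Θ' lam P)) :
    ∀ P : B12.RunParams, lam.kSel P < P.K → Step.InInterval γ P.K (gOfRecord₁₃Ax F 2 θ.toStage13Params P) → B15Leaf (WOfRecord₁₃Ax F 2 θ.toStage13Params lam P) := by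
  rw [hθ]
  exact hleaf

/-- **RUNG 1ⱽᵂ's N12 CONJUNCT AT AN ABSTRACT-WITNESS WORLD** (the world's `rBasicStep` leaf is TRUE on the window runs — e.g. pinned to `(exists_printedCarriers15_b15Leaf _).choose`, the K1 engine's
«W₀ UNREAD» shape): N12's leaf on the window runs at the bundle of record + the step row give the conjunct verbatim. [cite: Balaban1989LargeFieldI, (0.2)–(0.6) p.176, Prop. 1 p.194 (bookkeeping)] -/
theorem n12Pin_rung1VW_of_leafOnWindow (θ : Stage13HParams F 2) (h : θ.Provisos₁₃SepCoPHAx F 2) (v : Revision₁₃Ax F 2 θ h) (w : WorldP)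
    (hC : w.C = (datumOfRecord₁₃SepCoPHVAx F 2 θ h v).C) (lam : ResidW F 2) (hk : ∀ P : B12.RunParams, 1 ≤ P.K → lam.kSel P < P.K)
    (hleaf : ∀ P : B12.RunParams, lam.kSel P < P.K → Step.InInterval w.γ P.K (gOfRecord₁₃Ax F 2 θ.toStage13Params P) → B15Leaf (WOfRecord₁₃Ax F 2 θ.toStage13Params lam P))
    (hrb : ∀ P : B12.RunParams, lam.kSel P < P.K → (leavesP w P).smallCouplings → (leavesP w P).rBasicStep) :
    ∃ lam : ResidW F 2, (∀ P : B12.RunParams, 1 ≤ P.K → lam.kSel P < P.K) ∧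
      ∀ P : B12.RunParams, lam.kSel P < P.K → (leavesP w P).smallCouplings → ((leavesP w P).rBasicStep ↔ B15Leaf (WOfRecord₁₃Ax F 2 θ.toStage13Params lam P)) :=
  ⟨lam, hk, fun P hkP hsc =>
    ⟨fun _ => hleaf P hkP ((smallCouplings_leavesP_iff_stepInInterval_gOfRecord₁₃Ax θ h v w hC P).1 hsc), fun _ => hrb P hkP hsc⟩⟩

/-- **RUNG 1ⱽᵂ's N12 CONJUNCT AT A W-PINNED WORLD** (the world's `rBasicStep` leaf IS `B15Leaf (W₀ P)` — `Node00.upOfRecord₅C_pinW_rBasicStep_iff` ∕ `B15LeafKnitRecord7.rBasicStep_upOfRecord₅C_iff` — with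
`W₀ P = WOfRecord₁₃Ax θ λ P` on the pin's runs): the conjunct is the pin's bookkeeping; N12's leaf is then what the node `Nodes (leavesP w P)` asks (`hleaf`, not consumed here).
[cite: Balaban1989LargeFieldI, (0.2)–(0.6) p.176, Prop. 1 p.194 (bookkeeping)] -/
theorem n12Pin_rung1VW_of_rBasicStep_iff (θ : Stage13HParams F 2) (w : WorldP) (W₀ : B12.RunParams → PrintedCarriers15) (lam : ResidW F 2)
    (hk : ∀ P : B12.RunParams, 1 ≤ P.K → lam.kSel P < P.K) (hrb : ∀ P : B12.RunParams, (leavesP w P).rBasicStep ↔ B15Leaf (W₀ P))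
    (hW : ∀ P : B12.RunParams, lam.kSel P < P.K → W₀ P = WOfRecord₁₃Ax F 2 θ.toStage13Params lam P) :
    ∃ lam : ResidW F 2, (∀ P : B12.RunParams, 1 ≤ P.K → lam.kSel P < P.K) ∧
      ∀ P : B12.RunParams, lam.kSel P < P.K → (leavesP w P).smallCouplings → ((leavesP w P).rBasicStep ↔ B15Leaf (WOfRecord₁₃Ax F 2 θ.toStage13Params lam P)) :=
  ⟨lam, hk, fun P hkP _ => by rw [hrb P, hW P hkP]⟩

/-- … and at such a W-pinned world N12's NODE on the window runs IS its leaf on the window runs at the bundle of record (`B15LeafKnitRecord7.b15_main_of_up`'s shape: the node reads the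
`rBasicStep` leaf). [cite: Balaban1989LargeFieldI, Prop. 1 p.194, (0.4)–(0.6) p.176 (bookkeeping)] -/
theorem rBasicStep_onWindow_of_leafOnWindow (θ : Stage13HParams F 2) (h : θ.Provisos₁₃SepCoPHAx F 2) (v : Revision₁₃Ax F 2 θ h) (w : WorldP)
    (hC : w.C = (datumOfRecord₁₃SepCoPHVAx F 2 θ h v).C) (W₀ : B12.RunParams → PrintedCarriers15) (lam : ResidW F 2)
    (hrb : ∀ P : B12.RunParams, (leavesP w P).rBasicStep ↔ B15Leaf (W₀ P)) (hW : ∀ P : B12.RunParams, lam.kSel P < P.K → W₀ P = WOfRecord₁₃Ax F 2 θ.toStage13Params lam P)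
    (hleaf : ∀ P : B12.RunParams, lam.kSel P < P.K → Step.InInterval w.γ P.K (gOfRecord₁₃Ax F 2 θ.toStage13Params P) → B15Leaf (WOfRecord₁₃Ax F 2 θ.toStage13Params lam P)) :
    ∀ P : B12.RunParams, lam.kSel P < P.K → (leavesP w P).smallCouplings → (leavesP w P).rBasicStep := fun P hkP hsc => by
  rw [hrb P, hW P hkP]
  exact hleaf P hkP ((smallCouplings_leavesP_iff_stepInInterval_gOfRecord₁₃Ax θ h v w hC P).1 hsc)

end Conjunct

/-! ## §4 (v1.1)  «AT THE RUNG's BOUND θ»: the re-pin IS the identity exactly when θ's `p–p′` selector is the live one — ONE displayed row makes §3 read at θ itself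
(dag-lead g41 GATE v1.273 (c) ∕ `K1AX-V11-LINE-TABLE` v4 θ-OF-RECORD column: «shares are stated ∀θ or AT the rung's bound θ, never at a re-chosen θ′»).  The live re-pin is a statement about
the SELECTOR FIELD `ppSel` (`liveRepin₁₃Chi θ χ := {θ with ppSel := ppSelLiveOfRecord …}`), not about the (2.9) centre (σ7): N12's leaf at a bundle `WOfRecord₁₃Ax θ λ P` reads the piece
`θ.ppSel P g (k+1) s` SELECTED for each pre-𝐑 term `s`, and the (0.3)–(0.5) knit needs that piece to carry POSITIVE MASS (`…N12LeafIntAtRecord13Chi.b15Leaf_WOfRecord₁₃_of_massSel`'s row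
`hmassSel`, any selector); at the live selector this is «every LIVE term has positive mass» (`…N12AtRecord13LiveLine[Chi]`: `massSel_liveRepin₁₃_iff`, `hfib` free) — the row the junction
displays as `hmassLive`; at the identity selector of the numerics family (`Record12Numerics` :302 `ppSel := ppSelIdOfRecord`) it would ask positive mass of EVERY term, dead ones included. -/

section AtTheta

variable (F : T4Family) (N : ℕ) [NeZero N] (θ : Stage13Params F N) (χ : ChiSlot F N)

/-- AT THE RE-PIN THE SELECTOR IS THE LIVE ONE (`rfl`; the row §4's hypothesis asks, discharged for every witness built on the re-pin). [cite: Balaban1988Convergent, (3.22) p.269; Balaban1989LargeFieldI, (0.3) p.176 (bookkeeping)] -/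
theorem ppSel_liveRepin₁₃Ax :
    (θ.liveRepin₁₃Ax F N).ppSel =
      ppSelLiveOfRecord F N (θ.liveRepin₁₃Ax F N).ν (θ.liveRepin₁₃Ax F N).τ9 (EOfRecord₁₃Ax F N (θ.liveRepin₁₃Ax F N)) (wOfRecord₉ F N (θ.liveRepin₁₃Ax F N).toStage9Params) := rfl

variable {F N θ χ}

/-- **A PARAMETER WHOSE `p–p′` SELECTOR IS THE χ-LIVE ONE IS ITS OWN χ RE-PIN** (structure η). [cite: Balaban1988Convergent, (3.22) p.269; Balaban1987RG1, (2.9) p.266 (bookkeeping)] -/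
theorem liveRepin₁₃Chi_eq_self_of_ppSel (hsel : θ.ppSel = ppSelLiveOfRecord F N θ.ν θ.τ9 (EOfRecord₁₃Chi F N θ χ) (wOfRecord₉ F N θ.toStage9Params)) :
    θ.liveRepin₁₃Chi F N χ = θ := by
  unfold Stage13Params.liveRepin₁₃Chi
  rw [← hsel]

/-- **A PARAMETER WHOSE `p–p′` SELECTOR IS THE RE-CENTRED LIVE ONE IS ITS OWN RE-CENTRED RE-PIN** (structure η). [cite: Balaban1988Convergent, (3.22) p.269; Balaban1987RG1, (2.9) p.266 with (2.3) p.265 (bookkeeping)] -/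
theorem liveRepin₁₃Ax_eq_self_of_ppSel (hsel : θ.ppSel = ppSelLiveOfRecord F N θ.ν θ.τ9 (EOfRecord₁₃Ax F N θ) (wOfRecord₉ F N θ.toStage9Params)) :
    θ.liveRepin₁₃Ax F N = θ := by
  show θ.liveRepin₁₃Chi F N (chiβOfRecord₁₃Ax F N θ) = θ
  unfold Stage13Params.liveRepin₁₃Chi
  rw [← hsel]

/-- **N12's WINDOW-LOCAL LEAF AT THE RUNG's BOUND θ ITSELF, from the junction's conclusion at `θ.toStage13Params.liveRepin₁₃Ax`, under the ONE row «θ's selector is the live one»**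
(= §3's `leafOnWindow_at_witness_of_eq` with the equation supplied by `liveRepin₁₃Ax_eq_self_of_ppSel`). [cite: Balaban1989LargeFieldI, (0.2)–(0.6) p.176, Prop. 1 p.194, (1.80) p.195, (1.89) p.198, (1.102) p.201 (bookkeeping transport)] -/
theorem leafOnWindow_at_theta_of_ppSel_live (θ : Stage13HParams F 2)
    (hsel : θ.toStage13Params.ppSel = ppSelLiveOfRecord F 2 θ.ν θ.τ9 (EOfRecord₁₃Ax F 2 θ.toStage13Params) (wOfRecord₉ F 2 θ.toStage9Params)) (lam : ResidW F 2) (γ : ℝ)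
    (hleaf : ∀ P : B12.RunParams, lam.kSel P < P.K → Step.InInterval γ P.K (gOfRecord₁₃Ax F 2 (θ.toStage13Params.liveRepin₁₃Ax F 2) P) →
      B15Leaf (WOfRecord₁₃Ax F 2 (θ.toStage13Params.liveRepin₁₃Ax F 2) lam P)) :
    ∀ P : B12.RunParams, lam.kSel P < P.K → Step.InInterval γ P.K (gOfRecord₁₃Ax F 2 θ.toStage13Params P) → B15Leaf (WOfRecord₁₃Ax F 2 θ.toStage13Params lam P) :=
  leafOnWindow_at_witness_of_eq θ _ (liveRepin₁₃Ax_eq_self_of_ppSel hsel).symm lam γ hleaf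

end AtTheta


end Summit.QuantumFields.YangMills.BalabanUVNodes.N12PinAtRecordBundleForK1AxRung1VW

end
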